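import Literature.NumberTheory.Automorphic.RestrictedTensorProductLift
import Literature.NumberTheory.Automorphic.RestrictedProductCocycle
import HarnessLib

/-!
# Restricted tensor products of multiplier (projective) representations

Let `(W, j)` be a restricted tensor product `⊗'_i (V i, x₀ i)` of `k`-modules
(`IsRestrictedTensorProduct k j S₀`, tree `RestrictedTensorProduct`, explicit universal map in
`RestrictedTensorProductLift`), and let each `V i` carry a family of linear operators
`r i : G i → End(V i)` indexed by a group `G i` with a distinguished subgroup `K i` such that

* `hK` : for almost all `i`, every `r i k`, `k ∈ K i`, FIXES the base vector `x₀ i`.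

Then every `g = (g i) ∈ Πʳ i, [G i, K i]` (Mathlib's restricted product) acts on `W` by the operator
`piOp g = ⊗'_i r i (g i)` (`IsRestrictedTensorProduct.map` of the restricted family of local operators),
characterised by `piOp g (j x) = j ((r i (g i) (x i))_i)` (`piOp_apply`), with `piOp 1 = 1` when all
`r i 1 = 1` (`piOp_one`).

**Multipliers multiply.** If the local operators satisfy MULTIPLIER RELATIONS
`r i g ∘ r i g' = a i g g' • r i (g g')` with scalars `a i g g' ∈ k` trivial on `K i × K i` for almost
all `i`, then (`piOp_comp_piOp`)

  `piOp g ∘ piOp g' = (∏ᶠ i, a i (g i) (g' i)) • piOp (g g')`,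

the product being finite.  In the language of the tree's cocycle central extensions
(`Literature.GroupTheory.CocycleCentralExtension`, `RestrictedProductCocycle`): if `r i` has multiplier
the normalized 2-cocycle `c i : G i × G i → A` through a character `χ : A →* kˣ`
(`TwistedProduct.HasMultiplier (c i) (scalarEnd χ) (r i)`), and `c i ≡ 1` on `K i × K i` for almost all
`i`, then `piOp` has multiplier the ADELIC COCYCLE `piCocycle c = ∏_i c i` (`hasMultiplier_piOp`), the
scalars commute with every operator (`commute_scalarEnd`), and hence (`TwistedProduct.opHom`)

  `piOpHom : TwistedProduct (piCocycle c hc) →* Module.End k W`, `(g, a) ↦ χ(a) · ⊗'_i r i (g i)`,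

is an honest representation of the global metaplectic-type group `(Πʳ i G i) ×_{∏ c i} A` on the
restricted tensor product (`piOpHom_apply`, `piOpHom_sec`, `piOpHom_inl`).  This is the abstract
skeleton of the construction of the global Weil representation of the adelic metaplectic group from
the local Schrödinger models `r_v` with Rao's cocycles `c_v` (Weil 1964 n° 37–41; Harris–Kudla–Sweet
1996 §1; Kudla 1994 §3): every analytic / arithmetic input — that `K_v` fixes `1_{𝒪_v^n}` and that
`c_v ≡ 1` on `K_v × K_v` for almost all `v`, and the local multiplier relations — is an explicit
HYPOTHESIS here; nothing about any specific `r_v`, `c_v` is asserted.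

Everything in this file is proved (kernel); no cited fact is used.

## References

* [Flath1979] D. Flath, Decomposition of representations into tensor products, §2.
* [Weil1964] A. Weil, Sur certains groupes d'opérateurs unitaires, n° 37–41.
* [HarrisKudlaSweet1996] M. Harris, S. Kudla, W. Sweet, Theta dichotomy for unitary groups, §1.
* [Kudla1994] S. Kudla, Splitting metaplectic covers of dual reductive pairs, §3.
-/

namespace Literature.NumberTheory.Automorphic

open scoped RestrictedProduct TensorProduct
open Filter Function PiTensorProduct
open _root_.Literature.GroupTheory

universe u uk uG uA v w

/-! ### Scalars pull out of finitely many coordinates at once -/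

section SmulExtend

variable {ι : Type u} {k : Type uk} [CommRing k] {V : ι → Type v} [∀ i, AddCommGroup (V i)]
  [∀ i, Module k (V i)] {x₀ : ∀ i, V i} {W : Type w} [AddCommGroup W] [Module k W]
  [DecidableEq ι] {j : RestrictedFamily V x₀ → W}

/-- Multilinearity in all coordinates of a finset at once: scalars on the coordinates in `T` pull
out of a restricted-multilinear map as their product (Mathlib `MultilinearMap.map_smul_univ` for the
restriction to `T`). [folklore] -/
theorem IsRestrictedMultilinear.map_smul_extend (hj : IsRestrictedMultilinear k j) (T : Finset ι)
    (a : ↥T → k) (m : ∀ i : T, V i) :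
    j (RestrictedFamily.extend T fun i => a i • m i) =
      (∏ i, a i) • j (RestrictedFamily.extend T m) := by
  simpa only [IsRestrictedMultilinear.restrictMultilinear_apply] using
    (hj.restrictMultilinear T).map_smul_univ a m

/-- If `y i = a i • x i` for all `i`, with `a i = 1` and `x i = x₀ i` off a finset `T`, then
`j y = (∏_{i ∈ T} a i) • j x`. [folklore] -/
theorem IsRestrictedMultilinear.map_smul_family (hj : IsRestrictedMultilinear k j)
    (x y : RestrictedFamily V x₀) (a : ι → k) (T : Finset ι) (hx : ∀ i ∉ T, x i = x₀ i)
    (ha : ∀ i ∉ T, a i = 1) (hy : ∀ i, y i = a i • x i) :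
    j y = (∏ i ∈ T, a i) • j x := by
  have hyT : ∀ i ∉ T, y i = x₀ i := fun i hi => by rw [hy, ha i hi, one_smul, hx i hi]
  rw [← RestrictedFamily.extend_restrict T x hx, ← RestrictedFamily.extend_restrict T y hyT]
  have hfun : (fun i : T => y i) = fun i : T => (fun i : T => a i) i • (fun i : T => x i) i :=
    funext fun i => hy i
  rw [hfun, hj.map_smul_extend, Finset.prod_coe_sort]

/-- `finprod` form of `map_smul_family`. [folklore] -/
theorem IsRestrictedMultilinear.map_smul_family_finprod (hj : IsRestrictedMultilinear k j)
    (x y : RestrictedFamily V x₀) (a : ι → k) (T : Finset ι) (hx : ∀ i ∉ T, x i = x₀ i)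
    (ha : ∀ i ∉ T, a i = 1) (hy : ∀ i, y i = a i • x i) :
    j y = (∏ᶠ i, a i) • j x := by
  rw [hj.map_smul_family x y a T hx ha hy, finprod_eq_prod_of_mulSupport_subset a]
  intro i hi
  by_contra hiT
  exact hi (ha i hiT)

end SmulExtend

/-! ### The operators `⊗'_i r i (g i)` -/

section PiOp

variable {ι : Type u} {k : Type uk} [CommRing k] {G : ι → Type uG} [∀ i, Group (G i)]
  {K : ∀ i, Subgroup (G i)} {V : ι → Type v} [∀ i, AddCommGroup (V i)] [∀ i, Module k (V i)]
  {x₀ : ∀ i, V i} [DecidableEq ι] {W : Type w} [AddCommGroup W] [Module k W]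
  {j : RestrictedFamily V x₀ → W} {S₀ : Finset ι} (r : ∀ i, G i → (V i →ₗ[k] V i))

omit [DecidableEq ι] in
/-- For `g ∈ Πʳ i, [G i, K i]` the local operators `r i (g i)` fix the base vectors for almost all
`i` (as `g i ∈ K i` and `r i (K i)` fixes `x₀ i` for almost all `i`). [folklore] -/
theorem eventually_apply_base_eq (hK : ∀ᶠ i in cofinite, ∀ g ∈ K i, r i g (x₀ i) = x₀ i)
    (g : Πʳ i, [G i, K i]) : ∀ᶠ i in cofinite, r i (g i) (x₀ i) = x₀ i :=
  (hK.and g.2).mono fun _ hi => hi.1 _ hi.2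

namespace IsRestrictedTensorProduct

/-- **The operator `⊗'_i r i (g i)`** on a restricted tensor product `(W, j)`, for
`g ∈ Πʳ i, [G i, K i]`: the functorial map of the restricted family of local operators
`(r i (g i))_i` (base vectors fixed for almost all `i`). (Flath 1979, §2; the operators
`ω(g) = ⊗_v ω_v(g_v)` of the global Weil representation.) [cite: Flath1979, §2] -/
noncomputable def piOp (h : IsRestrictedTensorProduct k j S₀)
    (hK : ∀ᶠ i in cofinite, ∀ g ∈ K i, r i g (x₀ i) = x₀ i) (g : Πʳ i, [G i, K i]) :
    W →ₗ[k] W :=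
  h.map h.isRestrictedMultilinear (fun i => r i (g i)) (eventually_apply_base_eq r hK g)

/-- `(⊗' r i (g i)) (j x) = j ((r i (g i) (x i))_i)`. [folklore] -/
@[simp] theorem piOp_apply (h : IsRestrictedTensorProduct k j S₀)
    (hK : ∀ᶠ i in cofinite, ∀ g ∈ K i, r i g (x₀ i) = x₀ i) (g : Πʳ i, [G i, K i])
    (x : RestrictedFamily V x₀) :
    h.piOp r hK g (j x) =
      j (RestrictedFamily.piMap (fun i => r i (g i)) (eventually_apply_base_eq r hK g) x) :=
  h.map_apply _ _ _ x

/-- Uniqueness: a linear operator acting on the values `j x` as `⊗' r i (g i)` does IS `piOp g`.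
[folklore] -/
theorem eq_piOp (h : IsRestrictedTensorProduct k j S₀)
    (hK : ∀ᶠ i in cofinite, ∀ g ∈ K i, r i g (x₀ i) = x₀ i) (g : Πʳ i, [G i, K i])
    {F : W →ₗ[k] W}
    (hF : ∀ x, F (j x) =
      j (RestrictedFamily.piMap (fun i => r i (g i)) (eventually_apply_base_eq r hK g) x)) :
    F = h.piOp r hK g :=
  h.linearMap_ext fun x => by rw [hF, piOp_apply]

/-- `⊗' r i 1 = 1` when every `r i 1 = 1`. [folklore] -/
theorem piOp_one (h : IsRestrictedTensorProduct k j S₀)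
    (hK : ∀ᶠ i in cofinite, ∀ g ∈ K i, r i g (x₀ i) = x₀ i) (h1 : ∀ i, r i 1 = LinearMap.id) :
    h.piOp r hK 1 = LinearMap.id :=
  (h.eq_piOp r hK 1 (F := LinearMap.id) fun x => by
    rw [LinearMap.id_apply]
    congr 1
    ext i
    simp [h1]).symm

/-- **Multipliers multiply.** If `r i g ∘ r i g' = a i g g' • r i (g g')` for all `i, g, g'`, with
`a i ≡ 1` on `K i × K i` for almost all `i`, then
`(⊗' r i (g i)) ∘ (⊗' r i (g' i)) = (∏ᶠ i, a i (g i) (g' i)) • ⊗' r i (g i g' i)` — a finite product.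
(The computation behind "the cocycle of the adelic Weil representation is the product of the local
cocycles", Weil 1964 n° 37–38; HKS 1996 §1.) [folklore] -/
theorem piOp_comp_piOp (h : IsRestrictedTensorProduct k j S₀)
    (hK : ∀ᶠ i in cofinite, ∀ g ∈ K i, r i g (x₀ i) = x₀ i) (a : ∀ i, G i → G i → k)
    (hr : ∀ i (g g' : G i), r i g ∘ₗ r i g' = a i g g' • r i (g * g'))
    (ha : ∀ᶠ i in cofinite, ∀ g ∈ K i, ∀ g' ∈ K i, a i g g' = 1) (g g' : Πʳ i, [G i, K i]) :
    h.piOp r hK g ∘ₗ h.piOp r hK g' = (∏ᶠ i, a i (g i) (g' i)) • h.piOp r hK (g * g') := by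
  refine h.linearMap_ext fun x => ?_
  have hev : ∀ᶠ i in cofinite, x i = x₀ i ∧ g i ∈ K i ∧ g' i ∈ K i ∧
      (∀ g ∈ K i, ∀ g' ∈ K i, a i g g' = 1) ∧ ∀ g ∈ K i, r i g (x₀ i) = x₀ i :=
    x.eventually_eq.and (g.2.and (g'.2.and (ha.and hK)))
  rw [eventually_cofinite] at hev
  set T := hev.toFinset with hT_def
  have hT : ∀ i ∉ T, x i = x₀ i ∧ g i ∈ K i ∧ g' i ∈ K i ∧
      (∀ g ∈ K i, ∀ g' ∈ K i, a i g g' = 1) ∧ ∀ g ∈ K i, r i g (x₀ i) = x₀ i := by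
    intro i hi
    by_contra hc
    exact hi (hev.mem_toFinset.mpr hc)
  rw [LinearMap.comp_apply, piOp_apply, piOp_apply, LinearMap.smul_apply, piOp_apply]
  refine h.isRestrictedMultilinear.map_smul_family_finprod _ _ (fun i => a i (g i) (g' i)) T
    (fun i hi => ?_) (fun i hi => ?_) (fun i => ?_)
  · obtain ⟨hx, hg, hg', -, hfix⟩ := hT i hi
    simp only [RestrictedFamily.piMap_apply, RestrictedProduct.mul_apply, hx]
    exact hfix _ (mul_mem hg hg')
  · obtain ⟨-, hg, hg', ha', -⟩ := hT i hi
    exact ha' _ hg _ hg'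
  · simp only [RestrictedFamily.piMap_apply, RestrictedProduct.mul_apply]
    rw [← LinearMap.comp_apply, hr, LinearMap.smul_apply]

/-- `Module.End` form of `piOp_comp_piOp`. [folklore] -/
theorem piOp_mul_piOp (h : IsRestrictedTensorProduct k j S₀)
    (hK : ∀ᶠ i in cofinite, ∀ g ∈ K i, r i g (x₀ i) = x₀ i) (a : ∀ i, G i → G i → k)
    (hr : ∀ i (g g' : G i), r i g * r i g' = a i g g' • r i (g * g'))
    (ha : ∀ᶠ i in cofinite, ∀ g ∈ K i, ∀ g' ∈ K i, a i g g' = 1) (g g' : Πʳ i, [G i, K i]) :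
    h.piOp r hK g * h.piOp r hK g' = (∏ᶠ i, a i (g i) (g' i)) • h.piOp r hK (g * g') :=
  h.piOp_comp_piOp r hK a hr ha g g'

end IsRestrictedTensorProduct

end PiOp

/-! ### Cocycle multipliers: the representation of the global metaplectic-type group -/

section Cocycle

variable {ι : Type u} {k : Type uk} [CommRing k] {G : ι → Type uG} [∀ i, Group (G i)]
  {K : ∀ i, Subgroup (G i)} {A : Type uA} [CommGroup A] {V : ι → Type v}
  [∀ i, AddCommGroup (V i)] [∀ i, Module k (V i)] {x₀ : ∀ i, V i} [DecidableEq ι]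
  {W : Type w} [AddCommGroup W] [Module k W] {j : RestrictedFamily V x₀ → W} {S₀ : Finset ι}

variable (k W) in
/-- The scalar action of an abelian group `A` on a `k`-module through a character `χ : A →* kˣ`, as a
homomorphism into `Module.End k W`: `a ↦ χ(a) · 1`. (The centre `ℂ¹ ⊂ Mp(𝕎)` acting by the central
character.) [folklore] -/
def scalarEnd (χ : A →* kˣ) : A →* Module.End k W where
  toFun a := ((χ a : kˣ) : k) • (1 : Module.End k W)
  map_one' := by simp
  map_mul' a b := LinearMap.ext fun w => by simp [mul_smul, smul_comm (M := k) ((χ a : kˣ) : k)]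

/-- `scalarEnd χ a = χ(a) • 1`. [folklore] -/
@[simp] theorem scalarEnd_apply (χ : A →* kˣ) (a : A) :
    scalarEnd k W χ a = ((χ a : kˣ) : k) • (1 : Module.End k W) := rfl

/-- Scalars commute with every operator. [folklore] -/
theorem commute_scalarEnd (χ : A →* kˣ) (a : A) (F : Module.End k W) :
    Commute (scalarEnd k W χ a) F := by
  rw [Commute, SemiconjBy, scalarEnd_apply, smul_mul_assoc, mul_smul_comm, one_mul, mul_one]

/-- A multiplier relation through `scalarEnd χ` is the scalar relation
`r g ∘ r g' = χ(c(g,g')) • r (g g')`. [folklore] -/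
theorem hasMultiplier_scalarEnd_iff {H : Type*} [Group H] (c : CentralCocycle H A) (χ : A →* kˣ)
    (r : H → Module.End k W) :
    TwistedProduct.HasMultiplier c (scalarEnd k W χ) r ↔
      ∀ g g', r g * r g' = ((χ (c g g') : kˣ) : k) • r (g * g') := by
  refine forall_congr' fun g => forall_congr' fun g' => ?_
  rw [scalarEnd_apply, smul_mul_assoc, one_mul]

variable (r : ∀ i, G i → (V i →ₗ[k] V i)) (c : ∀ i, CentralCocycle (G i) A)
  (hc : ∀ᶠ i in cofinite, ∀ g ∈ K i, ∀ g' ∈ K i, c i g g' = 1) (χ : A →* kˣ)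

namespace IsRestrictedTensorProduct

/-- **The multiplier of `⊗' r i` is the adelic cocycle.** If each `r i` has multiplier the normalized
2-cocycle `c i` (through `χ`), and `c i ≡ 1` on `K i × K i` for almost all `i`, then `g ↦ ⊗' r i (g i)`
has multiplier `piCocycle c = ∏_i c i` on `Πʳ i, [G i, K i]`. (Weil 1964, n° 38; HKS 1996, §1:
"the global metaplectic group … with cocycle `∏_v c_v`".) [folklore] -/
theorem hasMultiplier_piOp (h : IsRestrictedTensorProduct k j S₀)
    (hK : ∀ᶠ i in cofinite, ∀ g ∈ K i, r i g (x₀ i) = x₀ i)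
    (hr : ∀ i, TwistedProduct.HasMultiplier (c i) (scalarEnd k (V i) χ) (r i)) :
    TwistedProduct.HasMultiplier (RestrictedCocycle.piCocycle c hc) (scalarEnd k W χ)
      (h.piOp r hK) := by
  rw [hasMultiplier_scalarEnd_iff]
  intro g g'
  have hr' : ∀ i (g g' : G i), r i g * r i g' = ((χ (c i g g') : kˣ) : k) • r i (g * g') :=
    fun i => (hasMultiplier_scalarEnd_iff (c i) χ (r i)).mp (hr i)
  have ha : ∀ᶠ i in cofinite, ∀ g ∈ K i, ∀ g' ∈ K i, (((χ (c i g g') : kˣ) : k)) = 1 :=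
    hc.mono fun i hi g hg g' hg' => by rw [hi g hg g' hg', map_one, Units.val_one]
  rw [h.piOp_mul_piOp r hK (fun i g g' => ((χ (c i g g') : kˣ) : k)) hr' ha g g',
    RestrictedCocycle.piCocycle_apply]
  congr 1
  have hfin : (mulSupport fun i => c i (g i) (g' i)).Finite :=
    RestrictedCocycle.finite_mulSupport_cocycle c hc g g'
  exact (((Units.coeHom k).comp χ).map_finprod hfin).symm

/-- **The representation of the global metaplectic-type group on the restricted tensor product**:
`(g, a) ↦ χ(a) · ⊗'_i r i (g i)` is a homomorphism `TwistedProduct (piCocycle c) →* End(W)`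
(tree `TwistedProduct.opHom` applied to `hasMultiplier_piOp`). Hypotheses: local multiplier relations,
`r i 1 = 1`, and the two "almost all `i`" conditions. (Weil 1964, n° 37–41; HKS 1996, §1; Kudla 1994,
§3: the global Weil representation `ω = ⊗_v ω_v` of `Mp(𝕎)(𝔸)`.) [folklore] -/
noncomputable def piOpHom (h : IsRestrictedTensorProduct k j S₀)
    (hK : ∀ᶠ i in cofinite, ∀ g ∈ K i, r i g (x₀ i) = x₀ i)
    (hr : ∀ i, TwistedProduct.HasMultiplier (c i) (scalarEnd k (V i) χ) (r i))
    (h1 : ∀ i, r i 1 = LinearMap.id) :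
    TwistedProduct (RestrictedCocycle.piCocycle c hc) →* Module.End k W :=
  TwistedProduct.opHom (h.hasMultiplier_piOp r c hc χ hK hr) (h.piOp_one r hK h1)
    fun a _ => commute_scalarEnd χ a _

/-- `piOpHom (g, a) = χ(a) • ⊗' r i (g i)`. [folklore] -/
theorem piOpHom_apply (h : IsRestrictedTensorProduct k j S₀)
    (hK : ∀ᶠ i in cofinite, ∀ g ∈ K i, r i g (x₀ i) = x₀ i)
    (hr : ∀ i, TwistedProduct.HasMultiplier (c i) (scalarEnd k (V i) χ) (r i))
    (h1 : ∀ i, r i 1 = LinearMap.id) (x : TwistedProduct (RestrictedCocycle.piCocycle c hc)) :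
    h.piOpHom r c hc χ hK hr h1 x = ((χ x.a : kˣ) : k) • h.piOp r hK x.g := by
  rw [piOpHom, TwistedProduct.opHom_apply, scalarEnd_apply, smul_mul_assoc, one_mul]

/-- On the canonical section: `piOpHom (sec g) = ⊗' r i (g i)`. [folklore] -/
@[simp] theorem piOpHom_sec (h : IsRestrictedTensorProduct k j S₀)
    (hK : ∀ᶠ i in cofinite, ∀ g ∈ K i, r i g (x₀ i) = x₀ i)
    (hr : ∀ i, TwistedProduct.HasMultiplier (c i) (scalarEnd k (V i) χ) (r i))
    (h1 : ∀ i, r i 1 = LinearMap.id) (g : Πʳ i, [G i, K i]) :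
    h.piOpHom r c hc χ hK hr h1 (TwistedProduct.sec _ g) = h.piOp r hK g :=
  TwistedProduct.opHom_sec _ _ _ g

/-- On the centre: `piOpHom (inl a) = χ(a) • 1`. [folklore] -/
@[simp] theorem piOpHom_inl (h : IsRestrictedTensorProduct k j S₀)
    (hK : ∀ᶠ i in cofinite, ∀ g ∈ K i, r i g (x₀ i) = x₀ i)
    (hr : ∀ i, TwistedProduct.HasMultiplier (c i) (scalarEnd k (V i) χ) (r i))
    (h1 : ∀ i, r i 1 = LinearMap.id) (a : A) :
    h.piOpHom r c hc χ hK hr h1 (TwistedProduct.inl _ a) = ((χ a : kˣ) : k) • 1 :=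
  TwistedProduct.opHom_inl _ _ _ a

/-- **Action on pure tensors**: `piOpHom (g, a) (j x) = χ(a) • j ((r i (g i) (x i))_i)`. [folklore] -/
theorem piOpHom_apply_apply (h : IsRestrictedTensorProduct k j S₀)
    (hK : ∀ᶠ i in cofinite, ∀ g ∈ K i, r i g (x₀ i) = x₀ i)
    (hr : ∀ i, TwistedProduct.HasMultiplier (c i) (scalarEnd k (V i) χ) (r i))
    (h1 : ∀ i, r i 1 = LinearMap.id) (x : TwistedProduct (RestrictedCocycle.piCocycle c hc))
    (y : RestrictedFamily V x₀) :
    h.piOpHom r c hc χ hK hr h1 x (j y) = ((χ x.a : kˣ) : k) •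
      j (RestrictedFamily.piMap (fun i => r i (x.g i)) (eventually_apply_base_eq r hK x.g) y) := by
  rw [piOpHom_apply, LinearMap.smul_apply, piOp_apply]

end IsRestrictedTensorProduct

end Cocycle

end Literature.NumberTheory.Automorphic
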